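import Literature.AlgebraicGeometry.HodgeTheory.HypersurfaceComplexPoints
import Literature.AlgebraicGeometry.Motives.AlgPointsProductProofs
import HarnessLib

/-!
# `L`-points of the fibre of a family over an `L`-point of the base

Topic: `Literature/AlgebraicGeometry/Motives`, companion to `AlgPoints` (the `L`-points `X(L)` of a
`k`-scheme with their strong topology). For a morphism `q : X → U` of `k`-schemes and an `L`-point
`u ∈ U(L)` (`L ⊇ k` a field), the **fibre** `X_u := X ×_{U, u} Spec L` is an `L`-scheme, and its
`L`-points over `L` are the `L`-points of `X` over `k` lying over `u`:

* `fibreOver q u : SchemeOver L` and `fibreOverToPoints q u : X_u(L) → X(L)`, `P ↦ pr₁ ∘ P`, with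
  `map q (fibreOverToPoints q u P) = u` and image `{e ∈ X(L) | q(e) = u}`
  (`range_fibreOverToPoints`);
* `isEmbedding_fibreOverToPoints` — for `U` separated over `k` and `L` a Hausdorff topological field,
  **`X_u(L) → X(L)` is an embedding** for the strong topologies: `X_u → X ×_k Spec L` is a closed
  immersion (a base change of the diagonal of `U/k`, Mathlib), closed immersions embed `L`-points
  (`AlgPoints.isEmbedding_map_of_isClosedImmersion`), `(X ×_k Spec L)(L) ≃ₜ X(L) × (Spec L)(L)`
  (`AlgPoints.isHomeomorph_prodEquiv`), and on `X_u(L)` the second component is constant;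
* `fibreHomeomorph q u : X_u(L) ≃ₜ {e ∈ X(L) | q(e) = u}` — the resulting homeomorphism onto the
  slice, `(fibreHomeomorph q u P).1 = fibreOverToPoints q u P`.

This is the identification "`(X_u)^{an} =` the fibre of `X^{an} → U^{an}` over `u`" on points, used to
compare the fibres of an algebraic family over two complex points of the base (e.g. over a
`ℚ̄`-point and over a very general point; Voisin, *Hodge loci and absolute Hodge classes*, §3;
SGA1 XIII for finite étale covers). Everything is proved; no named facts.

## References

* B. Conrad, *Weil and Grothendieck approaches to adelic points*, Enseign. Math. 58 (2012),
  Prop. 2.1 and Ex. 2.2 (functoriality of the topology on points, fibre products). [ConradAdelicPoints2012]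
* J.-P. Serre, *Géométrie algébrique et géométrie analytique* (GAGA), §2 n°5 (closed immersions). [SerreGAGA1956]
* R. Hartshorne, *Algebraic Geometry*, II.3 (fibres of a morphism, Thm. 3.3). [Hartshorne1977]
-/

noncomputable section

open CategoryTheory CategoryTheory.Limits AlgebraicGeometry Topology MonoidalCategory

set_option backward.isDefEq.respectTransparency false

namespace Literature.AlgebraicGeometry.Motives

namespace AlgPoints

variable {k : Type} [Field k] {L : Type} [Field L] [Algebra k L] {X U : SchemeOver k} (q : X ⟶ U)
  (u : AlgPoints U L)

/-- The structure morphism of `Spec L` over itself is the identity. [folklore] -/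
theorem specOver_self_hom : (specOver L L).hom = 𝟙 (Spec (.of L)) := by
  change Spec.map (CommRingCat.ofHom (RingHom.id L)) = _
  rw [CommRingCat.ofHom_id]
  exact Spec.map_id _

/-- An `L`-point of an `L`-scheme over `L` is a section: `P ≫ (structure map) = 𝟙`. [folklore] -/
theorem left_comp_hom_eq_id {Z : SchemeOver L} (P : AlgPoints Z L) : P.left ≫ Z.hom = 𝟙 _ := by
  rw [Over.w P]
  exact specOver_self_hom

/-- **The fibre `X_u := X ×_{U,u} Spec L` of `q : X → U` over the `L`-point `u ∈ U(L)`**, as an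
`L`-scheme (Hartshorne II.3). [folklore] -/
def fibreOver : SchemeOver L := Over.mk (pullback.snd q.left u.left)

/-- The underlying scheme of the fibre is `X ×_{U} Spec L` (by `rfl`). [folklore] -/
@[simp]
theorem fibreOver_left : (fibreOver q u).left = pullback q.left u.left := rfl

/-- The structure morphism of the fibre is the second projection (by `rfl`). [folklore] -/
@[simp]
theorem fibreOver_hom : (fibreOver q u).hom = pullback.snd q.left u.left := rfl

/-- **The point of `X` under a point of the fibre**: `X_u(L) → X(L)`, `P ↦ pr₁ ∘ P` (an `L`-point of
`X` over `k`). [folklore] -/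
def fibreOverToPoints (P : AlgPoints (fibreOver q u) L) : AlgPoints X L :=
  AlgPoints.mk (P.left ≫ pullback.fst q.left u.left) (by
    have hP : P.left ≫ pullback.snd q.left u.left = 𝟙 _ := left_comp_hom_eq_id P
    rw [Category.assoc, ← Over.w q, pullback.condition_assoc, reassoc_of% hP]
    exact Over.w u)

/-- The underlying morphism of `fibreOverToPoints q u P` is `P ≫ pr₁` (by `rfl`). [folklore] -/
@[simp]
theorem fibreOverToPoints_left (P : AlgPoints (fibreOver q u) L) :
    (fibreOverToPoints q u P).left = P.left ≫ pullback.fst q.left u.left := rfl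

/-- Points of the fibre lie over `u`: `q (pr₁ P) = u`. [folklore] -/
theorem map_fibreOverToPoints (P : AlgPoints (fibreOver q u) L) :
    map q (fibreOverToPoints q u P) = u := by
  have hP : P.left ≫ pullback.snd q.left u.left = 𝟙 _ := left_comp_hom_eq_id P
  apply Over.OverMorphism.ext
  rw [map_apply, Over.comp_left, fibreOverToPoints_left, Category.assoc, pullback.condition,
    reassoc_of% hP]

/-- `fibreOverToPoints` is injective (a point of the fibre over `L` is a section, determined by its
first component). [folklore] -/
theorem fibreOverToPoints_injective : Function.Injective (fibreOverToPoints q u) := by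
  intro P Q h
  have h' : P.left ≫ pullback.fst q.left u.left = Q.left ≫ pullback.fst q.left u.left :=
    congrArg CommaMorphism.left h
  apply Over.OverMorphism.ext
  apply pullback.hom_ext
  · exact h'
  · exact (left_comp_hom_eq_id (Z := fibreOver q u) P).trans
      (left_comp_hom_eq_id (Z := fibreOver q u) Q).symm

/-- The point of the fibre attached to a point `e ∈ X(L)` over `u`: `(e, 𝟙)`. [folklore] -/
def fibreOverOfPoint (e : AlgPoints X L) (he : map q e = u) : AlgPoints (fibreOver q u) L :=
  AlgPoints.mk (pullback.lift e.left (𝟙 _) (by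
      rw [Category.id_comp, ← Over.comp_left, ← map_apply, he]))
    (by rw [fibreOver_hom, pullback.lift_snd]; exact specOver_self_hom.symm)

/-- `fibreOverToPoints (fibreOverOfPoint e) = e`. [folklore] -/
@[simp]
theorem fibreOverToPoints_fibreOverOfPoint (e : AlgPoints X L) (he : map q e = u) :
    fibreOverToPoints q u (fibreOverOfPoint q u e he) = e := by
  apply Over.OverMorphism.ext
  rw [fibreOverToPoints_left]
  exact pullback.lift_fst _ _ _

/-- **The image of `X_u(L) → X(L)` is the slice `{e | q(e) = u}`.** [folklore] -/
theorem range_fibreOverToPoints :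
    Set.range (fibreOverToPoints q u) = {e | map q e = u} := by
  ext e
  constructor
  · rintro ⟨P, rfl⟩
    exact map_fibreOverToPoints q u P
  · intro he
    exact ⟨fibreOverOfPoint q u e he, fibreOverToPoints_fibreOverOfPoint q u e he⟩

/-! ### The fibre as a closed subscheme of `X ×_k Spec L` -/

/-- The fibre regarded over `k` (restriction of scalars along `k → L`). [folklore] -/
abbrev fibreOverRes : SchemeOver k := (Over.map (specOver k L).hom).obj (fibreOver q u)

/-- The projection `X_u → X` over `k`. [folklore] -/
def fibreOverFst : fibreOverRes q u ⟶ X :=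
  Over.homMk (pullback.fst q.left u.left) (by
    rw [Over.map_obj_hom, fibreOver_hom, ← Over.w q, pullback.condition_assoc, Over.w u])

/-- The projection `X_u → Spec L` over `k`. [folklore] -/
def fibreOverSnd : fibreOverRes q u ⟶ specOver k L :=
  Over.homMk (pullback.snd q.left u.left) rfl

/-- **The closed immersion `X_u → X ×_k Spec L`**, `(pr₁, pr₂)`, over `k`. [folklore] -/
def fibreOverToProd : fibreOverRes q u ⟶ X ⊗ specOver k L :=
  CartesianMonoidalCategory.lift (fibreOverFst q u) (fibreOverSnd q u)

/-- The underlying morphism of `fibreOverToProd` is Mathlib's `pullback.mapDesc` (the base change of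
the diagonal of `U → Spec k`) followed by the identification
`X ×_{U → Spec k} Spec L = X ×_k Spec L`. [folklore] -/
theorem fibreOverToProd_left :
    (fibreOverToProd q u).left = pullback.mapDesc q.left u.left U.hom ≫
      (pullback.congrHom (Over.w q) (Over.w u)).hom := by
  rw [fibreOverToProd, Over.lift_left]
  apply pullback.hom_ext
  · simp [fibreOverFst]
  · simp [fibreOverSnd]

/-- `X_u → X ×_k Spec L` is a closed immersion when `U` is separated over `k`. [folklore] -/
instance isClosedImmersion_fibreOverToProd_left [IsSeparated U.hom] :
    IsClosedImmersion (fibreOverToProd q u).left := by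
  rw [fibreOverToProd_left,
    MorphismProperty.cancel_right_of_respectsIso (P := @IsClosedImmersion)]
  infer_instance

/-- Regarding a point of `X_u` over `L` as a point over `k` (same underlying morphism). [folklore] -/
def fibreOverToRes (P : AlgPoints (fibreOver q u) L) : AlgPoints (fibreOverRes q u) L :=
  AlgPoints.mk P.left (by
    rw [Over.map_obj_hom, reassoc_of% (left_comp_hom_eq_id P)]
    rfl)

/-- `fibreOverToRes` does not change the underlying morphism (by `rfl`). [folklore] -/
@[simp]
theorem fibreOverToRes_left (P : AlgPoints (fibreOver q u) L) : (fibreOverToRes q u P).left = P.left :=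
  rfl

variable [TopologicalSpace L]

/-- `fibreOverToRes` is an embedding: injective, and both strong topologies are generated by the
values of the same regular functions on the same opens of `X_u`. [folklore] -/
theorem isEmbedding_fibreOverToRes : IsEmbedding (fibreOverToRes q u) := by
  refine ⟨⟨le_antisymm ?_ ?_⟩, fun P Q h ↦ Over.OverMorphism.ext ?_⟩
  rotate_left 2
  · have h' := congrArg CommaMorphism.left h
    exact h'
  · refine (continuous_generateFrom_iff.mpr ?_).le_induced
    rintro _ ⟨U, f, V, hV, rfl⟩
    exact isOpen_basicSet (X := fibreOver q u) U f hV
  · refine le_generateFrom ?_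
    rintro _ ⟨U, f, V, hV, rfl⟩
    exact ⟨basicSet (X := fibreOverRes q u) U f V, isOpen_basicSet _ _ hV, rfl⟩

/-- `fibreOverToPoints` is continuous. [folklore] -/
theorem continuous_fibreOverToPoints : Continuous (fibreOverToPoints q u) := by
  have h : fibreOverToPoints q u = map (fibreOverFst q u) ∘ fibreOverToRes q u := by
    funext P
    exact Over.OverMorphism.ext rfl
  rw [h]
  exact (continuous_map _).comp (isEmbedding_fibreOverToRes q u).continuous

variable [IsTopologicalDivisionRing L] [T1Space L]

omit [T1Space L] in
/-- An embedding into a product whose second component is constant has an embedding as first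
component. [folklore] -/
theorem _root_.Topology.IsEmbedding.fst_of_snd_eq {A B C : Type*} [TopologicalSpace A]
    [TopologicalSpace B] [TopologicalSpace C] {f : A → B × C} (hf : IsEmbedding f) (c : C)
    (hc : ∀ a, (f a).2 = c) : IsEmbedding (Prod.fst ∘ f) := by
  refine ⟨⟨?_⟩, fun a b h ↦ hf.injective (Prod.ext h (by rw [hc, hc]))⟩
  have h2 : Prod.snd ∘ f = fun _ ↦ c := funext hc
  rw [hf.eq_induced, instTopologicalSpaceProd, induced_inf, induced_compose, induced_compose, h2,
    induced_const, inf_top_eq]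

/-- **`X_u(L) → X(L)` is an embedding** for `U` separated over `k` and `L` a `T₁` topological field:
it is the first component of the embedding
`X_u(L) ↪ (X ×_k Spec L)(L) ≃ₜ X(L) × (Spec L)(L)` whose second component is constant (the
tautological point). [cite: ConradAdelicPoints2012, Prop. 2.1 and Ex. 2.2] -/
theorem isEmbedding_fibreOverToPoints [IsSeparated U.hom] : IsEmbedding (fibreOverToPoints q u) := by
  -- the embedding into the product
  let j : AlgPoints (fibreOver q u) L → AlgPoints X L × AlgPoints (specOver k L) L :=
    prodEquiv ∘ map (fibreOverToProd q u) ∘ fibreOverToRes q u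
  have hprod : IsEmbedding
      (prodEquiv : AlgPoints (X ⊗ specOver k L) L → AlgPoints X L × AlgPoints (specOver k L) L) :=
    (Homeomorph.mk prodEquiv continuous_prodEquiv continuous_prodEquiv_symm).isEmbedding
  have hj : IsEmbedding j :=
    hprod.comp ((isEmbedding_map_of_isClosedImmersion (fibreOverToProd q u)).comp
      (isEmbedding_fibreOverToRes q u))
  have h1 : Prod.fst ∘ j = fibreOverToPoints q u := by
    funext P
    apply Over.OverMorphism.ext
    change (map (CartesianMonoidalCategory.fst _ _) (map (fibreOverToProd q u) _)).left = _
    rw [← map_comp_apply, fibreOverToProd, CartesianMonoidalCategory.lift_fst]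
    rfl
  have h2 : ∀ P, (j P).2 = 𝟙 (specOver k L) := by
    intro P
    apply Over.OverMorphism.ext
    change (map (CartesianMonoidalCategory.snd _ _) (map (fibreOverToProd q u) _)).left = _
    rw [← map_comp_apply, fibreOverToProd, CartesianMonoidalCategory.lift_snd, map_apply,
      Over.comp_left, Over.id_left]
    exact left_comp_hom_eq_id P
  rw [← h1]
  exact hj.fst_of_snd_eq _ h2

/-- **The fibre over `u` is homeomorphic to the slice of `X(L)` over `u`**:
`X_u(L) ≃ₜ {e ∈ X(L) | q(e) = u}`, for `U` separated over `k` and `L` a `T₁` topological field.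
[cite: ConradAdelicPoints2012, Prop. 2.1 and Ex. 2.2] -/
def fibreHomeomorph [IsSeparated U.hom] :
    AlgPoints (fibreOver q u) L ≃ₜ {e : AlgPoints X L // map q e = u} :=
  (isEmbedding_fibreOverToPoints q u).toHomeomorph.trans
    (Homeomorph.setCongr (range_fibreOverToPoints q u))

/-- The slice point of `fibreHomeomorph q u P` is `fibreOverToPoints q u P` (by `rfl`). [folklore] -/
@[simp]
theorem fibreHomeomorph_apply_coe [IsSeparated U.hom] (P : AlgPoints (fibreOver q u) L) :
    ((fibreHomeomorph q u P : {e : AlgPoints X L // map q e = u}) : AlgPoints X L) =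
      fibreOverToPoints q u P := rfl

/-- The inverse of `fibreHomeomorph` on a slice point `e` is the point `(e, 𝟙)` of the fibre. [folklore] -/
theorem fibreHomeomorph_symm_apply [IsSeparated U.hom] (e : {e : AlgPoints X L // map q e = u}) :
    (fibreHomeomorph q u).symm e = fibreOverOfPoint q u e.1 e.2 := by
  apply (fibreHomeomorph q u).injective
  rw [Homeomorph.apply_symm_apply]
  apply Subtype.ext
  rw [fibreHomeomorph_apply_coe, fibreOverToPoints_fibreOverOfPoint]

end AlgPoints

end Literature.AlgebraicGeometry.Motives

end
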